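import Summits.ResolutionOfSingularities.ResolutionOfSingularities.Theses.SectionAscent
import Summits.ResolutionOfSingularities.ResolutionOfSingularities.Theorems.SectionAscentAffineToGlobalModificationPatching
import Summits.ResolutionOfSingularities.ResolutionOfSingularities.Theorems.PAlterationPicoverKernelHonesty
import Summits.ResolutionOfSingularities.ResolutionOfSingularities.Theorems.SectionAscentAffineToGlobalAffineSingularLocus
import Summits.ResolutionOfSingularities.ResolutionOfSingularities.Theorems.SectionAscentAffineToGlobalStalkTransfer
import Summits.ResolutionOfSingularities.ResolutionOfSingularities.Theorems.SectionAscentAffineToGlobalRegularBaseLocalization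
import Summits.ResolutionOfSingularities.ResolutionOfSingularities.Theorems.SectionAscentAffineToGlobalYardstickModel
import Summits.ResolutionOfSingularities.ResolutionOfSingularities.Theorems.SectionAscentAffineToGlobalFibreBaseLocalization
import Summits.ResolutionOfSingularities.ResolutionOfSingularities.Theorems.SectionAscentAffineToGlobalYardstickCharts
import Summits.ResolutionOfSingularities.ResolutionOfSingularities.Theorems.SectionAscentAffineToGlobalPhasedPatching
import Literature.AlgebraicGeometry.Resolution.BlowupsComposition
import Literature.AlgebraicGeometry.Resolution.QuasiProjectiveResolution
import HarnessLib

/-!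
# Crux `AffineToGlobal` (stmt-ResolutionOfSingularities-15961) — line `Sketch` (regular yardsticks)

Skeleton of the lead (a1), RESHAPE 2 ("phased patching": the kernel weakened from
`Sing`-supported to FIBRE-supported local desingularizations).

Reshape 1 (all TRUE stubs landed: `YardstickModel.stub_yardstickModel` p165737,
`StalkTransfer.stub_stalkTransfer` p164493, `RegularBaseLocalization.stub_regularBaseLocalization`
p165056; composition `RegularYardstick.resolutionInChar_of_regularKernel` p166577) closed the
crux modulo RIGreg = Temkin's condition (iii) at regular stalks with `Sing`-SUPPORTED centres.
Running the yardsticks one at a time ("phases") instead of Temkin's localisation on the join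
needs only FIBRE-supported centres (anything over the bad base point may be blown up), a
formally weaker kernel without the "blow-up along a `Sing`-supported ideal" artefact
(Cossart–Piltant 2019, p. 3). Composition `AffineToGlobal_of` (kernel-checked modulo stubs):

* `stub_yardstickCharts` (TRUE, the only use of H): finite family of open charts
  `φ i : T i ↪ Y` covering `Y`, one-shot blow-ups `b i : R i → T i` with `R i` regular integral
  of finite type, and the join `σ₀ : S₀ → Y` (blow-up along `J ≠ ⊥`) on which every extended
  centre `(𝓘 i).map (φ i)` becomes an effective Cartier divisor.
* `stub_fibreBaseLocalization` (TRUE; Temkin 2008 Prop. 2.3.4 (iii)⇒(ii) over the base `R` for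
  blow-ups of `R`, with fibre-supported local moves): every blow-up `M → R` admits a blow-up
  `M' → M` with regular source and centre lying over `π(Sing M)`.
* `stub_phasedPatching` (TRUE): from the charts, the join and the per-yardstick conclusion of
  `stub_fibreBaseLocalization`, a resolution of `Y` (phase `i` blows up the extension of the
  centre found over `R i`; it lies over `Y ∖ ⋃_{j<i} φ j (T j)`, so earlier phases survive).
* `stub_fibreKernel` (the OPEN kernel, fibre form, infinite case): at a regular point `x` of a
  characteristic-`p` variety, a blow-up of `Spec 𝒪_{X,x}` singular only over the closed point
  (and at infinitely many points) has a blow-up with centre over the closed point and regular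
  source. The finitely-singular case is the landed `AffineSingularLocus.stub_finiteSingularLocus`.
-/

noncomputable section

set_option linter.dupNamespace false -- mandated namespace of this single-conjunct summit

open CategoryTheory CategoryTheory.Limits AlgebraicGeometry TopologicalSpace IsLocalRing
open Literature.AlgebraicGeometry.Resolution

namespace Summit.ResolutionOfSingularities.ResolutionOfSingularities.Theorems.AffineToGlobal.RegularYardstick

/-- STUB (LANDED p166995, uses H): yardstick charts and their join. -/
theorem stub_yardstickCharts (p : ℕ)
    (h : ∀ d : ℕ, ∀ (K : Type) [Field K] [CharP K p] (A : Type) [CommRing A] [IsDomain A]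
      [Algebra K A] [Algebra.FiniteType K A], ringKrullDim A < (d : WithBot ℕ∞) →
      ∃ I : Ideal A, I ≠ ⊥ ∧
        Literature.AlgebraicGeometry.Resolution.Scheme.IsRegular
          (Literature.AlgebraicGeometry.Resolution.affineBlowup I) ∧
        ∀ 𝔭 : PrimeSpectrum A, I ≤ 𝔭.asIdeal ↔
          ¬ IsRegularLocalRing (Localization.AtPrime 𝔭.asIdeal))
    (K : Type) [Field K] [CharP K p] (Y : Scheme.{0}) [IsIntegral Y] (f : Y ⟶ Spec (.of K))
    [LocallyOfFiniteType f] [QuasiCompact f] :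
    ∃ (n : ℕ) (T R : Fin n → Scheme.{0}) (φ : ∀ i, T i ⟶ Y) (_ : ∀ i, IsOpenImmersion (φ i))
      (b : ∀ i, R i ⟶ T i) (𝓘 : ∀ i, (T i).IdealSheafData) (fR : ∀ i, R i ⟶ Spec (.of K))
      (_ : ∀ i, IsIntegral (R i)) (_ : ∀ i, LocallyOfFiniteType (fR i))
      (_ : ∀ i, QuasiCompact (fR i)) (S₀ : Scheme.{0}) (σ₀ : S₀ ⟶ Y) (J : Y.IdealSheafData),
      (∀ y : Y, ∃ i, y ∈ Set.range (φ i)) ∧ (∀ i, IsBlowup (b i) (𝓘 i)) ∧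
      (∀ i, Scheme.IsRegular (R i)) ∧ J ≠ ⊥ ∧ IsBlowup σ₀ J ∧
      ∀ i, IsEffectiveCartier (((𝓘 i).map (φ i)).comap σ₀) :=
  YardstickCharts.stub_yardstickCharts p h K Y f

/-- STUB (LANDED p166978): Temkin's localisation over the base for blow-ups of the base,
fibre-supported form. If for every `x ∈ R` every blow-up `S'` of `Spec 𝒪_{R,x}` singular only over the closed
point has a blow-up with centre over the closed point and regular source, then every blow-up
`π : M → R` has a blow-up `M' → M` with regular source whose centre lies over `π(Sing M)`. -/
theorem stub_fibreBaseLocalization (K : Type) [Field K] (R : Scheme.{0}) [IsIntegral R]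
    (fR : R ⟶ Spec (.of K)) [LocallyOfFiniteType fR] [QuasiCompact fR]
    (hloc : ∀ (x : R) (S' : Scheme.{0}) (g : S' ⟶ Spec (R.presheaf.stalk x))
      (I : (Spec (R.presheaf.stalk x)).IdealSheafData), IsBlowup g I →
      (∀ s : S', s ∉ Scheme.regularLocus S' → g s = closedPoint (R.presheaf.stalk x)) →
      ∃ (S'' : Scheme.{0}) (g' : S'' ⟶ S') (I' : S'.IdealSheafData), IsBlowup g' I' ∧
        (∀ s ∈ I'.support, g s = closedPoint (R.presheaf.stalk x)) ∧ Scheme.IsRegular S'')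
    (M : Scheme.{0}) (π : M ⟶ R) (J : R.IdealSheafData) (hπ : IsBlowup π J) :
    ∃ (M' : Scheme.{0}) (π' : M' ⟶ M) (J' : M.IdealSheafData), IsBlowup π' J' ∧
      (∀ m ∈ J'.support, ∃ m₁ : M, m₁ ∉ Scheme.regularLocus M ∧ π m = π m₁) ∧
      Scheme.IsRegular M' :=
  FibreBaseLocalization.stub_fibreBaseLocalization K R fR hloc M π J hπ

/-- STUB (LANDED p167416): phased patching. Given open charts `φ i : T i ↪ Y` covering the integral
variety `Y`, blow-ups `b i : R i → T i` with `R i` integral, the per-yardstick conclusion of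
`stub_fibreBaseLocalization` for each `R i`, and a blow-up `σ₀ : S₀ → Y` along `J ≠ ⊥` making
every extended centre an effective Cartier divisor, `Y` has a resolution of singularities. -/
theorem stub_phasedPatching (K : Type) [Field K] (Y : Scheme.{0}) [IsIntegral Y]
    (f : Y ⟶ Spec (.of K)) [LocallyOfFiniteType f] [QuasiCompact f]
    (n : ℕ) (T R : Fin n → Scheme.{0}) (φ : ∀ i, T i ⟶ Y) [∀ i, IsOpenImmersion (φ i)]
    (b : ∀ i, R i ⟶ T i) (𝓘 : ∀ i, (T i).IdealSheafData) [∀ i, IsIntegral (R i)]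
    (hcov : ∀ y : Y, ∃ i, y ∈ Set.range (φ i)) (hb : ∀ i, IsBlowup (b i) (𝓘 i))
    (hfib : ∀ i, ∀ (M : Scheme.{0}) (π : M ⟶ R i) (Q : (R i).IdealSheafData), IsBlowup π Q →
      ∃ (M' : Scheme.{0}) (π' : M' ⟶ M) (Q' : M.IdealSheafData), IsBlowup π' Q' ∧
        (∀ m ∈ Q'.support, ∃ m₁ : M, m₁ ∉ Scheme.regularLocus M ∧ π m = π m₁) ∧
        Scheme.IsRegular M')
    (S₀ : Scheme.{0}) (σ₀ : S₀ ⟶ Y) (J : Y.IdealSheafData) (hJ : J ≠ ⊥) (hσ₀ : IsBlowup σ₀ J)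
    (hcart : ∀ i, IsEffectiveCartier (((𝓘 i).map (φ i)).comap σ₀)) :
    Scheme.HasResolution Y :=
  PhasedPatching.stub_phasedPatching K Y f n T R φ b 𝓘 hcov hb hfib S₀ σ₀ J hJ hσ₀ hcart

/-- STUB (OPEN — the kernel of the idea card `regular-yardstick` in FIBRE form, infinite case):
granted the crux's hypothesis H in characteristic `p`, every blow-up of the local scheme at a
REGULAR point of an integral variety over a field of characteristic `p`, singular only over the
closed point and at infinitely many points, has a blow-up with centre over the closed point
and regular source. (The finitely-singular case is `AffineSingularLocus.stub_finiteSingularLocus`,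
landed, by H alone; the `Sing`-supported form RIGreg implies this one.) -/
theorem stub_fibreKernel (p : ℕ) (hp : p.Prime)
    (h : ∀ d : ℕ, ∀ (K : Type) [Field K] [CharP K p] (A : Type) [CommRing A] [IsDomain A]
      [Algebra K A] [Algebra.FiniteType K A], ringKrullDim A < (d : WithBot ℕ∞) →
      ∃ I : Ideal A, I ≠ ⊥ ∧
        Literature.AlgebraicGeometry.Resolution.Scheme.IsRegular
          (Literature.AlgebraicGeometry.Resolution.affineBlowup I) ∧
        ∀ 𝔭 : PrimeSpectrum A, I ≤ 𝔭.asIdeal ↔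
          ¬ IsRegularLocalRing (Localization.AtPrime 𝔭.asIdeal))
    (K : Type) [Field K] [CharP K p] (X : Scheme.{0}) [IsIntegral X] (f : X ⟶ Spec (.of K))
    [LocallyOfFiniteType f] [QuasiCompact f] (x : X) (hx : x ∈ Scheme.regularLocus X)
    (S' : Scheme.{0}) (g : S' ⟶ Spec (X.presheaf.stalk x))
    (I : (Spec (X.presheaf.stalk x)).IdealSheafData) (hg : IsBlowup g I)
    (hs : ∀ s : S', s ∉ Scheme.regularLocus S' → g s = closedPoint (X.presheaf.stalk x))
    (hinf : (Scheme.regularLocus S')ᶜ.Infinite) :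
    ∃ (S'' : Scheme.{0}) (g' : S'' ⟶ S') (I' : S'.IdealSheafData), IsBlowup g' I' ∧
      (∀ s ∈ I'.support, g s = closedPoint (X.presheaf.stalk x)) ∧ Scheme.IsRegular S'' := by
  sorry

/-- The fibre-form local condition at a point `x` of `X` from the kernel (infinite case) and
the landed finitely-singular case: a `Sing`-supported desingularization has its centre over
the closed point. -/
theorem fibreLocal_of_kernel (p : ℕ) (hp : p.Prime)
    (h : ∀ d : ℕ, ∀ (K : Type) [Field K] [CharP K p] (A : Type) [CommRing A] [IsDomain A]
      [Algebra K A] [Algebra.FiniteType K A], ringKrullDim A < (d : WithBot ℕ∞) →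
      ∃ I : Ideal A, I ≠ ⊥ ∧
        Literature.AlgebraicGeometry.Resolution.Scheme.IsRegular
          (Literature.AlgebraicGeometry.Resolution.affineBlowup I) ∧
        ∀ 𝔭 : PrimeSpectrum A, I ≤ 𝔭.asIdeal ↔
          ¬ IsRegularLocalRing (Localization.AtPrime 𝔭.asIdeal))
    (hker : ∀ (K : Type) [Field K] [CharP K p] (X : Scheme.{0}) [IsIntegral X]
      (f : X ⟶ Spec (.of K)) [LocallyOfFiniteType f] [QuasiCompact f] (x : X),
      x ∈ Scheme.regularLocus X →
      ∀ (S' : Scheme.{0}) (g : S' ⟶ Spec (X.presheaf.stalk x))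
        (I : (Spec (X.presheaf.stalk x)).IdealSheafData), IsBlowup g I →
        (∀ s : S', s ∉ Scheme.regularLocus S' → g s = closedPoint (X.presheaf.stalk x)) →
        (Scheme.regularLocus S')ᶜ.Infinite →
        ∃ (S'' : Scheme.{0}) (g' : S'' ⟶ S') (I' : S'.IdealSheafData), IsBlowup g' I' ∧
          (∀ s ∈ I'.support, g s = closedPoint (X.presheaf.stalk x)) ∧ Scheme.IsRegular S'')
    (K : Type) [Field K] [CharP K p] (X : Scheme.{0}) [IsIntegral X] (f : X ⟶ Spec (.of K))
    [LocallyOfFiniteType f] [QuasiCompact f] (x : X) (hx : x ∈ Scheme.regularLocus X)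
    (S' : Scheme.{0}) (g : S' ⟶ Spec (X.presheaf.stalk x))
    (I : (Spec (X.presheaf.stalk x)).IdealSheafData) (hg : IsBlowup g I)
    (hs : ∀ s : S', s ∉ Scheme.regularLocus S' → g s = closedPoint (X.presheaf.stalk x)) :
    ∃ (S'' : Scheme.{0}) (g' : S'' ⟶ S') (I' : S'.IdealSheafData), IsBlowup g' I' ∧
      (∀ s ∈ I'.support, g s = closedPoint (X.presheaf.stalk x)) ∧ Scheme.IsRegular S'' := by
  by_cases hfin : (Scheme.regularLocus S')ᶜ.Finite
  · obtain ⟨S'', g', ⟨I', hg', hI'⟩, hreg⟩ :=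
      AffineSingularLocus.stub_finiteSingularLocus p hp h K X f x S' g I hg hfin
    exact ⟨S'', g', I', hg', fun s hs' => hs s (hI' hs'), hreg⟩
  · exact hker K X f x hx S' g I hg hs hfin

/-- **Resolution in characteristic `p` from H and the FIBRE kernel** (composition of line
`Sketch`, reshape 2): yardstick charts and their join, phased patching with the per-yardstick
conclusion of the fibre-form base localisation fed by the kernel at the (regular) points of the
yardsticks, then the landed projective reduction. -/
theorem resolutionInChar_of_fibreKernel (p : ℕ) (hp : p.Prime)
    (h : ∀ d : ℕ, ∀ (K : Type) [Field K] [CharP K p] (A : Type) [CommRing A] [IsDomain A]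
      [Algebra K A] [Algebra.FiniteType K A], ringKrullDim A < (d : WithBot ℕ∞) →
      ∃ I : Ideal A, I ≠ ⊥ ∧
        Literature.AlgebraicGeometry.Resolution.Scheme.IsRegular
          (Literature.AlgebraicGeometry.Resolution.affineBlowup I) ∧
        ∀ 𝔭 : PrimeSpectrum A, I ≤ 𝔭.asIdeal ↔
          ¬ IsRegularLocalRing (Localization.AtPrime 𝔭.asIdeal))
    (hker : ∀ (K : Type) [Field K] [CharP K p] (X : Scheme.{0}) [IsIntegral X]
      (f : X ⟶ Spec (.of K)) [LocallyOfFiniteType f] [QuasiCompact f] (x : X),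
      x ∈ Scheme.regularLocus X →
      ∀ (S' : Scheme.{0}) (g : S' ⟶ Spec (X.presheaf.stalk x))
        (I : (Spec (X.presheaf.stalk x)).IdealSheafData), IsBlowup g I →
        (∀ s : S', s ∉ Scheme.regularLocus S' → g s = closedPoint (X.presheaf.stalk x)) →
        (Scheme.regularLocus S')ᶜ.Infinite →
        ∃ (S'' : Scheme.{0}) (g' : S'' ⟶ S') (I' : S'.IdealSheafData), IsBlowup g' I' ∧
          (∀ s ∈ I'.support, g s = closedPoint (X.presheaf.stalk x)) ∧ Scheme.IsRegular S'') :
    ResolutionInChar.{0} p := by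
  intro k _ _ X f hsep hlft hqc hred
  refine Theorems.WeightedThesis.ProjectiveIntegralSuffices.stub_projectiveIntegralSuffices k
    (fun n Y ι hι hint => ?_) X f hsep hlft hqc hred
  haveI := hι
  haveI := hint
  haveI : IsProper (Literature.AlgebraicGeometry.Motives.projectiveSpace n k).hom :=
    Literature.AlgebraicGeometry.Motives.isProper_projectiveSpace n k
  let fY : Y ⟶ Spec (.of k) := ι ≫ (Literature.AlgebraicGeometry.Motives.projectiveSpace n k).hom
  haveI : LocallyOfFiniteType fY := inferInstance
  haveI : QuasiCompact fY := inferInstance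
  obtain ⟨m, T, R, φ, hφ, b, 𝓘, fR, hRint, hRft, hRqc, S₀, σ₀, J, hcov, hb, hRreg, hJ, hσ₀,
    hcart⟩ := stub_yardstickCharts p h k Y fY
  refine stub_phasedPatching k Y fY m T R φ b 𝓘 hcov hb (fun i M π Q hπ => ?_) S₀ σ₀ J hJ hσ₀
    hcart
  haveI := hRint i
  haveI := hRft i
  haveI := hRqc i
  exact stub_fibreBaseLocalization k (R i) (fR i)
    (fun x S' g I hg hs => fibreLocal_of_kernel p hp h hker k (R i) (fR i) x
      ((Scheme.mem_regularLocus x).mpr (hRreg i x)) S' g I hg hs) M π Q hπ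

/-- **The crux `AffineToGlobal` from the stubs of line `Sketch`** (composition, by name). -/
theorem AffineToGlobal_of :
    Summit.ResolutionOfSingularities.ResolutionOfSingularities.Theses.SectionAscent.AffineToGlobal :=
  fun p hp hH => resolutionInChar_of_fibreKernel p hp hH
    (fun K _ _ X _ f _ _ x hx S' g I hg hs hinf =>
      stub_fibreKernel p hp hH K X f x hx S' g I hg hs hinf)

end Summit.ResolutionOfSingularities.ResolutionOfSingularities.Theorems.AffineToGlobal.RegularYardstick

end
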